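import Literature.Analysis.FluidPDE.OnsagerBDSVPotentialTheory
import Literature.Analysis.FunctionSpaces.ContDiffHolderLeibniz
import Mathlib.Analysis.Calculus.MeanValue
import HarnessLib

/-!
# The BDSV gluing stage: higher-order and vector forms of the Hölder Calderón–Zygmund bound

Buckmaster–De Lellis–Székelyhidi–Vicol, *Onsager's conjecture for admissible weak solutions*,
CPAM 72 (2019) = arXiv:1701.08678, use the boundedness of the second Riesz transforms
`∂ᵢ∂ⱼΔ⁻¹` on Hölder spaces (App. C, Prop. C.1; the named fact `BDSV.holderCZBound` of
`OnsagerBDSVPotentialTheory.lean`, stated in `C^{0,α}`) in §3 in three derived forms: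
in `C^{N,α}` for every `N` ("Schauder estimates", proofs of Prop. 3.1 and Prop. 3.3, (3.13)),
for vector fields, and with a gain of one derivative for the first-order potentials
`∂ᵢΔ⁻¹`, `ℬ = -Δ⁻¹ curl` (§3.3, (3.16): "`∇ℬ` is a bounded operator on Hölder spaces"). This file
derives them from `BDSV.holderCZBound` (as a hypothesis `hCZ`), with the accepted norms
`Torus.eContDiffHolderNorm N α`:

* `BDSV.holderCZBound.rieszHessian_le`: `‖∂ᵢ∂ⱼΔ⁻¹f‖_{N,α} ≤ C ‖f‖_{N,α}` for smooth real `f`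
  (induction on `N`: `∂ₖ` commutes with `∂ᵢ∂ⱼΔ⁻¹`, and `‖g‖_{N+1,α} ≤ ‖g‖_∞ + ∑ₖ ‖∂ₖg‖_{N,α}`);
* `BDSV.holderCZBound.rieszHessian_vec_le`: the same for `ℝ³`-valued fields (componentwise);
* `BDSV.holderCZBound.partialDeriv_invLaplacian_le`: `‖∂ᵢΔ⁻¹f‖_{N+1,α} ≤ C ‖f‖_{N,α}` (the
  zero-mean function `∂ᵢΔ⁻¹f` is bounded by `√3 ‖D ∂ᵢΔ⁻¹f‖_∞`, `BDSV.eSupNorm_le_of_integral_eq_zero`,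
  and `∂ₖ∂ᵢΔ⁻¹f` is a second Riesz transform), with its vector form and the Biot–Savart bound
  `BDSV.holderCZBound.biotSavart_le`: `‖ℬw‖_{N+1,α} ≤ C ‖w‖_{N,α}`.

Supporting lemmas (general torus `T^d`): comparison of orders `‖g‖_{j,r} ≤ 3^{k-j} ‖g‖_{k,r}`,
`‖Dg‖_{N,r} ≤ ∑ₖ ‖∂ₖg‖_{N,r}`, components of vector fields, and the sup bound for zero-mean
functions.

## References

* T. Buckmaster, C. De Lellis, L. Székelyhidi Jr., V. Vicol, *Onsager's conjecture for admissible
  weak solutions*, Comm. Pure Appl. Math. 72 (2019) 229–274 = arXiv:1701.08678: §3.1 (proof of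
  Prop. 3.1, "Schauder estimates"), §3.2 (3.13), §3.3 (3.16), App. C Prop. C.1.
-/

noncomputable section

open MeasureTheory Set Filter Function
open scoped ContDiff NNReal ENNReal

set_option maxSynthPendingDepth 3

namespace Literature.Analysis.FluidPDE

namespace BDSV

open FunctionSpaces FunctionSpaces.Torus

/-! ## General `C^{k,r}(T^d)` lemmas -/

section General

variable {d : Type} [Fintype d] {Y : Type} [NormedAddCommGroup Y] [NormedSpace ℝ Y]

/-- **Comparison of orders**: `‖g‖_{j,r} ≤ 3^{k-j} ‖g‖_{k,r}` for smooth `g` on `T^d`, `j ≤ k`,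
`r ≤ 1` (iterating `Torus.eContDiffHolderNorm_le_three_mul_succ`). [folklore] -/
theorem eContDiffHolderNorm_le_pow_mul_of_le {g : UnitAddTorus d → Y} (hg : IsSmooth g) {r : ℝ≥0}
    (hr : r ≤ 1) {j k : ℕ} (hjk : j ≤ k) :
    Torus.eContDiffHolderNorm j r g ≤ 3 ^ (k - j) * Torus.eContDiffHolderNorm k r g := by
  induction k with
  | zero =>
    obtain rfl := Nat.le_zero.1 hjk
    simp
  | succ k IH =>
    rcases Nat.lt_or_eq_of_le hjk with h | rfl
    · have hjk' : j ≤ k := Nat.lt_succ_iff.1 h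
      calc Torus.eContDiffHolderNorm j r g ≤ 3 ^ (k - j) * Torus.eContDiffHolderNorm k r g := IH hjk'
        _ ≤ 3 ^ (k - j) * (3 * Torus.eContDiffHolderNorm (k + 1) r g) :=
            mul_le_mul' le_rfl (Torus.eContDiffHolderNorm_le_three_mul_succ
              (hg.isContDiff (by exact_mod_cast le_top)) hr r)
        _ = 3 ^ (k + 1 - j) * Torus.eContDiffHolderNorm (k + 1) r g := by
            rw [← mul_assoc, ← pow_succ, Nat.succ_sub hjk']
    · simp

/-- The rank-one map `y ↦ (h ↦ hₖ • y)` from `Y` to `ℝ^d →L Y` has norm at most `1`. [folklore] -/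
theorem norm_smulRight_proj_le (k : d) :
    ‖(ContinuousLinearMap.smulRightL ℝ (EuclideanSpace ℝ d) Y (EuclideanSpace.proj k))‖ ≤ 1 := by
  refine ContinuousLinearMap.opNorm_le_bound _ zero_le_one fun y => ?_
  rw [one_mul]
  refine ContinuousLinearMap.opNorm_le_bound _ (norm_nonneg y) fun h => ?_
  have h1 : ‖h k‖ ≤ ‖h‖ := PiLp.norm_apply_le h k
  calc ‖ContinuousLinearMap.smulRightL ℝ (EuclideanSpace ℝ d) Y (EuclideanSpace.proj k) y h‖
      = ‖h k • y‖ := by simp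
    _ = ‖h k‖ * ‖y‖ := norm_smul _ _
    _ ≤ ‖h‖ * ‖y‖ := by gcongr
    _ = ‖y‖ * ‖h‖ := mul_comm _ _

/-- **The derivative through partial derivatives**: `‖Dg‖_{N,r} ≤ ∑ₖ ‖∂ₖg‖_{N,r}` for smooth `g`
on `T^d` (`Dg(x)h = ∑ₖ hₖ ∂ₖg(x)`). [folklore] -/
theorem eContDiffHolderNorm_fderiv_le_sum [DecidableEq d] {g : UnitAddTorus d → Y} (hg : IsSmooth g) (N : ℕ)
    (r : ℝ≥0) :
    Torus.eContDiffHolderNorm N r (Torus.fderiv g) ≤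
      ∑ k, Torus.eContDiffHolderNorm N r (partialDeriv k g) := by
  set L : d → (Y →L[ℝ] (EuclideanSpace ℝ d →L[ℝ] Y)) := fun k =>
    ContinuousLinearMap.smulRightL ℝ (EuclideanSpace ℝ d) Y (EuclideanSpace.proj k) with hL
  have hrepr : Torus.fderiv g = ∑ k, fun x => L k (partialDeriv k g x) := by
    funext x
    refine ContinuousLinearMap.ext fun h => ?_
    rw [fderiv_apply_eq_sum_partialDeriv (hg.isContDiff (by simp)) x h, Finset.sum_apply,
      FunLike.coe_sum, Finset.sum_apply]
    refine Finset.sum_congr rfl fun k _ => ?_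
    simp [hL]
  rw [hrepr]
  have hsm : ∀ k, IsContDiff N (fun x => L k (partialDeriv k g x)) := fun k =>
    ((hg.partialDeriv k).comp_clm (L k)).isContDiff (by exact_mod_cast le_top)
  refine (Torus.eContDiffHolderNorm_sum_le Finset.univ fun k _ => hsm k).trans
    (Finset.sum_le_sum fun k _ => ?_)
  refine (Torus.eContDiffHolderNorm_clm_comp_le (L k)
    ((hg.partialDeriv k).isContDiff (by exact_mod_cast le_top)) r).trans ?_
  have h1 : ‖L k‖ₑ ≤ 1 := by
    rw [← ofReal_norm, ← ENNReal.ofReal_one]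
    exact ENNReal.ofReal_le_ofReal (norm_smulRight_proj_le k)
  calc ‖L k‖ₑ * Torus.eContDiffHolderNorm N r (partialDeriv k g)
      ≤ 1 * Torus.eContDiffHolderNorm N r (partialDeriv k g) := mul_le_mul' h1 le_rfl
    _ = _ := one_mul _

/-- `‖g‖_{N+1,r} ≤ ‖g‖_∞ + ∑ₖ ‖∂ₖg‖_{N,r}` for smooth `g` on `T^d`. [folklore] -/
theorem eContDiffHolderNorm_succ_le_sum [DecidableEq d] {g : UnitAddTorus d → Y} (hg : IsSmooth g) (N : ℕ)
    (r : ℝ≥0) :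
    Torus.eContDiffHolderNorm (N + 1) r g ≤
      eSupNorm g + ∑ k, Torus.eContDiffHolderNorm N r (partialDeriv k g) := by
  rw [Torus.eContDiffHolderNorm_succ_eq_fderiv]
  exact add_le_add le_rfl (eContDiffHolderNorm_fderiv_le_sum hg N r)

/-- A component of a vector field is dominated in `C^{N,r}` by the field. [folklore] -/
theorem eContDiffHolderNorm_coord_le {ι : Type} [Fintype ι] {z : UnitAddTorus d → EuclideanSpace ℝ ι}
    (hz : IsSmooth z) (N : ℕ) (r : ℝ≥0) (b : ι) :
    Torus.eContDiffHolderNorm N r (fun x => z x b) ≤ Torus.eContDiffHolderNorm N r z := by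
  have h := Torus.eContDiffHolderNorm_clm_comp_le (EuclideanSpace.proj b : EuclideanSpace ℝ ι →L[ℝ] ℝ)
    (hz.isContDiff (n := N) (by exact_mod_cast le_top)) r
  have h1 : ‖(EuclideanSpace.proj b : EuclideanSpace ℝ ι →L[ℝ] ℝ)‖ₑ ≤ 1 := by
    rw [← ofReal_norm, ← ENNReal.ofReal_one]
    refine ENNReal.ofReal_le_ofReal (ContinuousLinearMap.opNorm_le_bound _ zero_le_one fun h => ?_)
    simpa using PiLp.norm_apply_le h b
  calc Torus.eContDiffHolderNorm N r (fun x => z x b)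
      ≤ ‖(EuclideanSpace.proj b : EuclideanSpace ℝ ι →L[ℝ] ℝ)‖ₑ * Torus.eContDiffHolderNorm N r z := h
    _ ≤ 1 * Torus.eContDiffHolderNorm N r z := mul_le_mul' h1 le_rfl
    _ = _ := one_mul _

/-- The rank-one map `c ↦ c • e_b` from `ℝ` to `ℝ^ι` has norm at most `1`. [folklore] -/
theorem norm_smulRight_single_le {ι : Type} [Fintype ι] [DecidableEq ι] (b : ι) :
    ‖(ContinuousLinearMap.id ℝ ℝ).smulRight (EuclideanSpace.single b (1 : ℝ))‖ ≤ 1 := by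
  refine ContinuousLinearMap.opNorm_le_bound _ zero_le_one fun c => ?_
  rw [ContinuousLinearMap.smulRight_apply, ContinuousLinearMap.id_apply, norm_smul, one_mul]
  simp

/-- A vector field is dominated in `C^{N,r}` by the sum of its components. [folklore] -/
theorem eContDiffHolderNorm_le_sum_coord {ι : Type} [Fintype ι] [DecidableEq ι]
    {z : UnitAddTorus d → EuclideanSpace ℝ ι} (hz : IsSmooth z) (N : ℕ) (r : ℝ≥0) :
    Torus.eContDiffHolderNorm N r z ≤ ∑ b, Torus.eContDiffHolderNorm N r (fun x => z x b) := by
  set L : ι → (ℝ →L[ℝ] EuclideanSpace ℝ ι) := fun b =>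
    (ContinuousLinearMap.id ℝ ℝ).smulRight (EuclideanSpace.single b (1 : ℝ)) with hL
  have hrepr : z = ∑ b, fun x => L b (z x b) := by
    funext x
    rw [Finset.sum_apply]
    conv_lhs => rw [← (EuclideanSpace.basisFun ι ℝ).sum_repr (z x)]
    refine Finset.sum_congr rfl fun b _ => ?_
    simp [hL]
  have hzb : ∀ b, IsSmooth (fun x => z x b) := fun b =>
    hz.comp_clm (EuclideanSpace.proj b : EuclideanSpace ℝ ι →L[ℝ] ℝ)
  have hsm : ∀ b, IsContDiff N (fun x => L b (z x b)) := fun b =>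
    ((hzb b).comp_clm (L b)).isContDiff (by exact_mod_cast le_top)
  conv_lhs => rw [hrepr]
  refine (Torus.eContDiffHolderNorm_sum_le Finset.univ fun b _ => hsm b).trans
    (Finset.sum_le_sum fun b _ => ?_)
  refine (Torus.eContDiffHolderNorm_clm_comp_le (L b)
    ((hzb b).isContDiff (by exact_mod_cast le_top)) r).trans ?_
  have h1 : ‖L b‖ₑ ≤ 1 := by
    rw [← ofReal_norm, ← ENNReal.ofReal_one]
    exact ENNReal.ofReal_le_ofReal (norm_smulRight_single_le b)
  calc ‖L b‖ₑ * Torus.eContDiffHolderNorm N r (fun x => z x b)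
      ≤ 1 * Torus.eContDiffHolderNorm N r (fun x => z x b) := mul_le_mul' h1 le_rfl
    _ = _ := one_mul _

/-! ## The sup norm of a zero-mean function -/

omit [Fintype d] in
/-- Representatives in the fundamental cube are at Euclidean distance at most `√d`. [folklore] -/
theorem norm_repr_sub_repr_le [Fintype d] (x x' : UnitAddTorus d) :
    ‖repr x - repr x'‖ ≤ Real.sqrt (Fintype.card d) := by
  rw [EuclideanSpace.norm_eq]
  refine Real.sqrt_le_sqrt ?_
  have h : ∀ i, ‖(repr x - repr x') i‖ ^ 2 ≤ 1 := fun i => by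
    have h1 := repr_apply_mem_Ico x i
    have h2 := repr_apply_mem_Ico x' i
    have h3 : |repr x i - repr x' i| ≤ 1 :=
      abs_sub_le_iff.2 ⟨by linarith [h1.2, h2.1], by linarith [h1.1, h2.2]⟩
    have h4 : ‖(repr x - repr x') i‖ = |repr x i - repr x' i| := by
      simp [Real.norm_eq_abs]
    rw [h4]
    exact (sq_le_one_iff_abs_le_one _).2 ((abs_abs _).le.trans h3)
  calc ∑ i, ‖(repr x - repr x') i‖ ^ 2 ≤ ∑ _i : d, (1 : ℝ) := Finset.sum_le_sum fun i _ => h i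
    _ = Fintype.card d := by simp

/-- **Sup bound for zero-mean functions on the torus.** A smooth real function with zero mean
vanishes somewhere (its minimum is `≤ 0 ≤` its maximum; intermediate values along the lift), so
it is bounded by `√d` times the sup of its derivative. [folklore] -/
theorem norm_le_of_integral_eq_zero {ψ : UnitAddTorus d → ℝ} (hψ : IsSmooth ψ)
    (h0 : ∫ x, ψ x = 0) {K : ℝ} (hK : ∀ x, ‖Torus.fderiv ψ x‖ ≤ K) (x : UnitAddTorus d) :
    ‖ψ x‖ ≤ Real.sqrt (Fintype.card d) * K := by
  have hc : Continuous ψ := hψ.continuous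
  -- minimum and maximum
  obtain ⟨xm, -, hxm⟩ := isCompact_univ.exists_isMinOn univ_nonempty hc.continuousOn
  obtain ⟨xM, -, hxM⟩ := isCompact_univ.exists_isMaxOn univ_nonempty hc.continuousOn
  have hmin : ψ xm ≤ 0 := by
    have h := integral_mono (integrable_const (ψ xm)) hψ.integrable fun y => hxm (mem_univ y)
    rw [integral_const, h0, smul_eq_mul] at h
    simpa using h
  have hmax : 0 ≤ ψ xM := by
    have h := integral_mono hψ.integrable (integrable_const (ψ xM)) fun y => hxM (mem_univ y)
    rw [integral_const, h0, smul_eq_mul] at h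
    simpa using h
  -- a zero of the lift, inside the fundamental cube
  have hcl : Continuous (lift ψ) := continuous_lift_iff.2 hc
  obtain ⟨y₀, hy₀⟩ : (0 : ℝ) ∈ range (lift ψ) := by
    refine intermediate_value_univ (repr xm) (repr xM) hcl ⟨?_, ?_⟩
    · rwa [lift_repr]
    · rwa [lift_repr]
  set y₁ : EuclideanSpace ℝ d := repr (proj y₀) with hy₁
  have hy₁0 : lift ψ y₁ = 0 := by
    rw [hy₁, lift_repr, ← hy₀, lift_apply]
  -- mean value inequality on `ℝ^d`
  have hdiff : ∀ y ∈ (univ : Set (EuclideanSpace ℝ d)), DifferentiableAt ℝ (lift ψ) y := fun y _ =>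
    (hψ.differentiable (by simp)).differentiableAt
  have hbound : ∀ y ∈ (univ : Set (EuclideanSpace ℝ d)), ‖_root_.fderiv ℝ (lift ψ) y‖ ≤ K :=
    fun y _ => by rw [fderiv_lift]; exact hK _
  have h := convex_univ.norm_image_sub_le_of_norm_fderiv_le hdiff hbound (mem_univ y₁)
    (mem_univ (repr x))
  rw [hy₁0, sub_zero, lift_repr] at h
  refine h.trans ?_
  rw [mul_comm]
  have hK0 : 0 ≤ K := (norm_nonneg _).trans (hK x)
  exact mul_le_mul_of_nonneg_right (norm_repr_sub_repr_le x (proj y₀)) hK0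

/-- Extended form: `‖ψ‖_∞ ≤ √d ‖Dψ‖_∞` for smooth zero-mean `ψ` (`d` nonempty). [folklore] -/
theorem eSupNorm_le_of_integral_eq_zero [Nonempty d] {ψ : UnitAddTorus d → ℝ} (hψ : IsSmooth ψ)
    (h0 : ∫ x, ψ x = 0) :
    eSupNorm ψ ≤ ENNReal.ofReal (Real.sqrt (Fintype.card d)) * eSupNorm (Torus.fderiv ψ) := by
  by_cases hT : eSupNorm (Torus.fderiv ψ) = ⊤
  · have h0' : ENNReal.ofReal (Real.sqrt (Fintype.card d)) ≠ 0 := by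
      rw [Ne, ENNReal.ofReal_eq_zero, not_le, Real.sqrt_pos, Nat.cast_pos]
      exact Fintype.card_pos
    rw [hT, ENNReal.mul_top h0']
    exact le_top
  refine iSup_le fun x => ?_
  have hK : ∀ x', ‖Torus.fderiv ψ x'‖ ≤ (eSupNorm (Torus.fderiv ψ)).toReal := fun x' => by
    rw [← ENNReal.ofReal_le_iff_le_toReal hT, ofReal_norm]
    exact enorm_le_eSupNorm _ x'
  have h := norm_le_of_integral_eq_zero hψ h0 hK x
  rw [← ofReal_norm, ← ENNReal.ofReal_toReal hT, ← ENNReal.ofReal_mul (Real.sqrt_nonneg _)]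
  exact ENNReal.ofReal_le_ofReal h

end General

/-! ## Consequences of `BDSV.holderCZBound` -/

section Schauder

variable {F : Type*} [NormedAddCommGroup F] [NormedSpace ℝ F]

/-- `∂ₖ` commutes with `∂ᵢ∂ⱼΔ⁻¹` on smooth functions. [folklore] -/
theorem partialDeriv_rieszHessian {f : UnitAddTorus (Fin 3) → F} (hf : IsSmooth f) (i j k : Fin 3) :
    partialDeriv k (rieszHessian i j f) = rieszHessian i j (partialDeriv k f) := by
  have h1 : rieszHessian i j f = invLaplacian (partialDeriv i (partialDeriv j f)) :=
    funext fun x => rieszHessian_eq_invLaplacian_partialDeriv_partialDeriv hf i j x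
  have h2 : rieszHessian i j (partialDeriv k f) =
      invLaplacian (partialDeriv i (partialDeriv j (partialDeriv k f))) :=
    funext fun x => rieszHessian_eq_invLaplacian_partialDeriv_partialDeriv (hf.partialDeriv k) i j x
  rw [h1, h2]
  funext x
  rw [partialDeriv_invLaplacian ((hf.partialDeriv j).partialDeriv i) k x]
  congr 1
  funext y
  rw [partialDeriv_comm (hf.partialDeriv j) k i y]
  congr 1
  funext y'
  exact partialDeriv_comm hf k j y'

/-- **`∂ᵢ∂ⱼΔ⁻¹` on `C^{N,α}(T³)`** (BDSV App. C Prop. C.1 in all orders, "Schauder estimates" of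
§3.1 and (3.13)): from `BDSV.holderCZBound`, for `0 < α < 1` and every `N` there is `C` with
`‖∂ᵢ∂ⱼΔ⁻¹f‖_{C^{N,α}} ≤ C ‖f‖_{C^{N,α}}` for all `i, j` and smooth real `f`. [cite: BuckmasterEtAl2018, App. C Prop. C.1] -/
theorem holderCZBound.rieszHessian_le (hCZ : holderCZBound) {α : ℝ≥0} (hα : 0 < α) (hα1 : α < 1)
    (N : ℕ) :
    ∃ C : ℝ≥0, ∀ (i j : Fin 3) (f : UnitAddTorus (Fin 3) → ℝ), IsSmooth f →
      Torus.eContDiffHolderNorm N α (rieszHessian i j f) ≤ C * Torus.eContDiffHolderNorm N α f := by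
  obtain ⟨C₀, hC₀⟩ := hCZ α hα hα1
  induction N with
  | zero => exact ⟨C₀, hC₀⟩
  | succ N IH =>
    obtain ⟨C, hC⟩ := IH
    refine ⟨C₀ * 3 ^ (N + 1) + 3 * C, fun i j f hf => ?_⟩
    have hg : IsSmooth (rieszHessian i j f) := isSmooth_rieszHessian hf i j
    have hfN : IsContDiff (N + 1 : ℕ) f := hf.isContDiff (by exact_mod_cast le_top)
    -- the sup norm
    have h1 : eSupNorm (rieszHessian i j f) ≤
        (C₀ : ℝ≥0∞) * 3 ^ (N + 1) * Torus.eContDiffHolderNorm (N + 1) α f :=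
      calc eSupNorm (rieszHessian i j f) ≤ Torus.eContDiffHolderNorm 0 α (rieszHessian i j f) :=
            Torus.eSupNorm_le_eContDiffHolderNorm 0 α _
        _ ≤ C₀ * Torus.eContDiffHolderNorm 0 α f := hC₀ i j f hf
        _ ≤ C₀ * (3 ^ (N + 1 - 0) * Torus.eContDiffHolderNorm (N + 1) α f) :=
            mul_le_mul' le_rfl (eContDiffHolderNorm_le_pow_mul_of_le hf hα1.le (Nat.zero_le _))
        _ = (C₀ : ℝ≥0∞) * 3 ^ (N + 1) * Torus.eContDiffHolderNorm (N + 1) α f := by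
            rw [Nat.sub_zero, mul_assoc]
    -- the partial derivatives
    have h2 : ∀ k, Torus.eContDiffHolderNorm N α (partialDeriv k (rieszHessian i j f)) ≤
        C * Torus.eContDiffHolderNorm (N + 1) α f := fun k =>
      calc Torus.eContDiffHolderNorm N α (partialDeriv k (rieszHessian i j f))
          = Torus.eContDiffHolderNorm N α (rieszHessian i j (partialDeriv k f)) := by
            rw [partialDeriv_rieszHessian hf]
        _ ≤ C * Torus.eContDiffHolderNorm N α (partialDeriv k f) := hC i j _ (hf.partialDeriv k)
        _ ≤ C * Torus.eContDiffHolderNorm (N + 1) α f :=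
            mul_le_mul' le_rfl (Torus.eContDiffHolderNorm_partialDeriv_le hfN k α)
    calc Torus.eContDiffHolderNorm (N + 1) α (rieszHessian i j f)
        ≤ eSupNorm (rieszHessian i j f) + ∑ k, Torus.eContDiffHolderNorm N α
            (partialDeriv k (rieszHessian i j f)) := eContDiffHolderNorm_succ_le_sum hg N α
      _ ≤ (C₀ : ℝ≥0∞) * 3 ^ (N + 1) * Torus.eContDiffHolderNorm (N + 1) α f +
            ∑ _k : Fin 3, (C : ℝ≥0∞) * Torus.eContDiffHolderNorm (N + 1) α f :=
          add_le_add h1 (Finset.sum_le_sum fun k _ => h2 k)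
      _ = ((C₀ * 3 ^ (N + 1) + 3 * C : ℝ≥0) : ℝ≥0∞) * Torus.eContDiffHolderNorm (N + 1) α f := by
          simp only [Finset.sum_const, Finset.card_univ, Fintype.card_fin, nsmul_eq_mul]
          push_cast
          ring

/-- **`∂ᵢ∂ⱼΔ⁻¹` on `C^{N,α}` vector fields** (componentwise): from `BDSV.holderCZBound`, for
`0 < α < 1` and `N` there is `C` with `‖∂ᵢ∂ⱼΔ⁻¹z‖_{C^{N,α}} ≤ C ‖z‖_{C^{N,α}}` for smooth
`z : T³ → ℝ³`. [cite: BuckmasterEtAl2018, App. C Prop. C.1] -/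
theorem holderCZBound.rieszHessian_vec_le (hCZ : holderCZBound) {α : ℝ≥0} (hα : 0 < α)
    (hα1 : α < 1) (N : ℕ) :
    ∃ C : ℝ≥0, ∀ (i j : Fin 3) (z : UnitAddTorus (Fin 3) → EuclideanSpace ℝ (Fin 3)), IsSmooth z →
      Torus.eContDiffHolderNorm N α (rieszHessian i j z) ≤ C * Torus.eContDiffHolderNorm N α z := by
  obtain ⟨C, hC⟩ := hCZ.rieszHessian_le hα hα1 N
  refine ⟨3 * C, fun i j z hz => ?_⟩
  have hg : IsSmooth (rieszHessian i j z) := isSmooth_rieszHessian hz i j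
  calc Torus.eContDiffHolderNorm N α (rieszHessian i j z)
      ≤ ∑ b, Torus.eContDiffHolderNorm N α (fun x => rieszHessian i j z x b) :=
        eContDiffHolderNorm_le_sum_coord hg N α
    _ = ∑ b, Torus.eContDiffHolderNorm N α (rieszHessian i j (fun x => z x b)) := by
        refine Finset.sum_congr rfl fun b _ => ?_
        congr 1
        funext x
        exact (rieszHessian_apply_coord hz i j x b).symm
    _ ≤ ∑ _b : Fin 3, (C : ℝ≥0∞) * Torus.eContDiffHolderNorm N α z :=
        Finset.sum_le_sum fun b _ =>
          (hC i j _ (hz.comp_clm (EuclideanSpace.proj b : EuclideanSpace ℝ (Fin 3) →L[ℝ] ℝ))).trans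
            (mul_le_mul' le_rfl (eContDiffHolderNorm_coord_le hz N α b))
    _ = ((3 * C : ℝ≥0) : ℝ≥0∞) * Torus.eContDiffHolderNorm N α z := by
        simp only [Finset.sum_const, Finset.card_univ, Fintype.card_fin, nsmul_eq_mul]
        push_cast
        ring

/-- **The first-order potentials `∂ᵢΔ⁻¹` gain one derivative** (BDSV §3.3: "`∇ℬ` is a bounded
operator on Hölder spaces", here for `∂ᵢΔ⁻¹` on scalars): from `BDSV.holderCZBound`, for
`0 < α < 1` and `N` there is `C` with `‖∂ᵢΔ⁻¹f‖_{C^{N+1,α}} ≤ C ‖f‖_{C^{N,α}}` for smooth real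
`f` (the derivatives `∂ₖ∂ᵢΔ⁻¹f` are second Riesz transforms, and the zero-mean function `∂ᵢΔ⁻¹f`
is bounded by `√3 ‖D∂ᵢΔ⁻¹f‖_∞`). [cite: BuckmasterEtAl2018, §3.3 (3.16)] -/
theorem holderCZBound.partialDeriv_invLaplacian_le (hCZ : holderCZBound) {α : ℝ≥0} (hα : 0 < α)
    (hα1 : α < 1) (N : ℕ) :
    ∃ C : ℝ≥0, ∀ (i : Fin 3) (f : UnitAddTorus (Fin 3) → ℝ), IsSmooth f →
      Torus.eContDiffHolderNorm (N + 1) α (partialDeriv i (invLaplacian f)) ≤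
        C * Torus.eContDiffHolderNorm N α f := by
  obtain ⟨C, hC⟩ := hCZ.rieszHessian_le hα hα1 N
  refine ⟨9 * C, fun i f hf => ?_⟩
  set ψ : UnitAddTorus (Fin 3) → ℝ := partialDeriv i (invLaplacian f) with hψ
  have hψs : IsSmooth ψ := (isSmooth_invLaplacian hf).partialDeriv i
  have hψ0 : ∫ x, ψ x = 0 := integral_partialDeriv_eq_zero_holds (isSmooth_invLaplacian hf) i
  have hk : ∀ k, partialDeriv k ψ = rieszHessian k i f := fun k => rfl
  have hsum : ∑ k, Torus.eContDiffHolderNorm N α (partialDeriv k ψ) ≤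
      3 * C * Torus.eContDiffHolderNorm N α f :=
    calc ∑ k, Torus.eContDiffHolderNorm N α (partialDeriv k ψ)
        ≤ ∑ _k : Fin 3, (C : ℝ≥0∞) * Torus.eContDiffHolderNorm N α f :=
          Finset.sum_le_sum fun k _ => by rw [hk]; exact hC k i f hf
      _ = 3 * C * Torus.eContDiffHolderNorm N α f := by
          simp only [Finset.sum_const, Finset.card_univ, Fintype.card_fin, nsmul_eq_mul]
          push_cast
          ring
  have hsup : eSupNorm ψ ≤ 2 * (3 * C * Torus.eContDiffHolderNorm N α f) := by
    have h3 : ENNReal.ofReal (Real.sqrt (Fintype.card (Fin 3))) ≤ 2 := by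
      rw [Fintype.card_fin, ← ENNReal.ofReal_ofNat 2]
      refine ENNReal.ofReal_le_ofReal ?_
      rw [Real.sqrt_le_left (by norm_num)]
      norm_num
    calc eSupNorm ψ ≤ ENNReal.ofReal (Real.sqrt (Fintype.card (Fin 3))) * eSupNorm (Torus.fderiv ψ) :=
          eSupNorm_le_of_integral_eq_zero hψs hψ0
      _ ≤ 2 * (Torus.eContDiffHolderNorm N α (Torus.fderiv ψ)) :=
          mul_le_mul' h3 (Torus.eSupNorm_le_eContDiffHolderNorm N α _)
      _ ≤ 2 * ∑ k, Torus.eContDiffHolderNorm N α (partialDeriv k ψ) :=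
          mul_le_mul' le_rfl (eContDiffHolderNorm_fderiv_le_sum hψs N α)
      _ ≤ 2 * (3 * C * Torus.eContDiffHolderNorm N α f) := mul_le_mul' le_rfl hsum
  calc Torus.eContDiffHolderNorm (N + 1) α ψ
      ≤ eSupNorm ψ + ∑ k, Torus.eContDiffHolderNorm N α (partialDeriv k ψ) :=
        eContDiffHolderNorm_succ_le_sum hψs N α
    _ ≤ 2 * (3 * C * Torus.eContDiffHolderNorm N α f) + 3 * C * Torus.eContDiffHolderNorm N α f :=
        add_le_add hsup hsum
    _ = ((9 * C : ℝ≥0) : ℝ≥0∞) * Torus.eContDiffHolderNorm N α f := by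
        push_cast
        ring

/-- Components of `∂ᵢΔ⁻¹` of a vector field: `(∂ᵢΔ⁻¹z)_b = ∂ᵢΔ⁻¹(z_b)`. [folklore] -/
theorem partialDeriv_invLaplacian_apply_coord {z : UnitAddTorus (Fin 3) → EuclideanSpace ℝ (Fin 3)}
    (hz : IsSmooth z) (i : Fin 3) (x : UnitAddTorus (Fin 3)) (b : Fin 3) :
    partialDeriv i (invLaplacian z) x b = partialDeriv i (invLaplacian (fun y => z y b)) x := by
  have h : (fun y => z y b) = (EuclideanSpace.proj b : EuclideanSpace ℝ (Fin 3) →L[ℝ] ℝ) ∘ z := rfl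
  rw [h, invLaplacian_clm_comp hz, show partialDeriv i ((EuclideanSpace.proj b : EuclideanSpace ℝ (Fin 3) →L[ℝ] ℝ) ∘
      invLaplacian z) x = (EuclideanSpace.proj b : EuclideanSpace ℝ (Fin 3) →L[ℝ] ℝ)
        (partialDeriv i (invLaplacian z) x) from partialDeriv_clm_comp (isSmooth_invLaplacian hz) _ i x]
  rfl

/-- **`∂ᵢΔ⁻¹` gains one derivative on vector fields**: from `BDSV.holderCZBound`, for
`0 < α < 1` and `N` there is `C` with `‖∂ᵢΔ⁻¹z‖_{C^{N+1,α}} ≤ C ‖z‖_{C^{N,α}}` for smooth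
`z : T³ → ℝ³`. [cite: BuckmasterEtAl2018, §3.3 (3.16)] -/
theorem holderCZBound.partialDeriv_invLaplacian_vec_le (hCZ : holderCZBound) {α : ℝ≥0}
    (hα : 0 < α) (hα1 : α < 1) (N : ℕ) :
    ∃ C : ℝ≥0, ∀ (i : Fin 3) (z : UnitAddTorus (Fin 3) → EuclideanSpace ℝ (Fin 3)), IsSmooth z →
      Torus.eContDiffHolderNorm (N + 1) α (partialDeriv i (invLaplacian z)) ≤
        C * Torus.eContDiffHolderNorm N α z := by
  obtain ⟨C, hC⟩ := hCZ.partialDeriv_invLaplacian_le hα hα1 N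
  refine ⟨3 * C, fun i z hz => ?_⟩
  have hg : IsSmooth (partialDeriv i (invLaplacian z)) := (isSmooth_invLaplacian hz).partialDeriv i
  calc Torus.eContDiffHolderNorm (N + 1) α (partialDeriv i (invLaplacian z))
      ≤ ∑ b, Torus.eContDiffHolderNorm (N + 1) α (fun x => partialDeriv i (invLaplacian z) x b) :=
        eContDiffHolderNorm_le_sum_coord hg (N + 1) α
    _ = ∑ b, Torus.eContDiffHolderNorm (N + 1) α (partialDeriv i (invLaplacian (fun y => z y b))) := by
        refine Finset.sum_congr rfl fun b _ => ?_
        congr 1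
        funext x
        exact partialDeriv_invLaplacian_apply_coord hz i x b
    _ ≤ ∑ _b : Fin 3, (C : ℝ≥0∞) * Torus.eContDiffHolderNorm N α z :=
        Finset.sum_le_sum fun b _ =>
          (hC i _ (hz.comp_clm (EuclideanSpace.proj b : EuclideanSpace ℝ (Fin 3) →L[ℝ] ℝ))).trans
            (mul_le_mul' le_rfl (eContDiffHolderNorm_coord_le hz N α b))
    _ = ((3 * C : ℝ≥0) : ℝ≥0∞) * Torus.eContDiffHolderNorm N α z := by
        simp only [Finset.sum_const, Finset.card_univ, Fintype.card_fin, nsmul_eq_mul]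
        push_cast
        ring

/-- **The Biot–Savart potential gains one derivative** (BDSV §3.3 (3.16): "`∇ℬ` is a bounded
operator on Hölder spaces"): from `BDSV.holderCZBound`, for `0 < α < 1` and `N` there is `C` with
`‖ℬw‖_{C^{N+1,α}} ≤ C ‖w‖_{C^{N,α}}` for smooth `w : T³ → ℝ³` (`ℬw = -curl Δ⁻¹w`, each component a
difference of two components of some `∂ₐΔ⁻¹w`). [cite: BuckmasterEtAl2018, §3.3 (3.16)] -/
theorem holderCZBound.biotSavart_le (hCZ : holderCZBound) {α : ℝ≥0} (hα : 0 < α) (hα1 : α < 1)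
    (N : ℕ) :
    ∃ C : ℝ≥0, ∀ (w : UnitAddTorus (Fin 3) → EuclideanSpace ℝ (Fin 3)), IsSmooth w →
      Torus.eContDiffHolderNorm (N + 1) α (biotSavart w) ≤ C * Torus.eContDiffHolderNorm N α w := by
  obtain ⟨C, hC⟩ := hCZ.partialDeriv_invLaplacian_vec_le hα hα1 N
  refine ⟨3 * (2 * C), fun w hw => ?_⟩
  have hB : biotSavart w = -curl (invLaplacian w) := by
    rw [biotSavart_eq]
    congr 1
    funext x
    exact invLaplacian_curl hw x
  have hsm : IsSmooth (curl (invLaplacian w)) := isSmooth_curl (isSmooth_invLaplacian hw)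
  have hP : ∀ a, IsSmooth (partialDeriv a (invLaplacian w)) := fun a =>
    (isSmooth_invLaplacian hw).partialDeriv a
  have hPb : ∀ a b, Torus.eContDiffHolderNorm (N + 1) α (fun x => partialDeriv a (invLaplacian w) x b) ≤
      C * Torus.eContDiffHolderNorm N α w := fun a b =>
    (eContDiffHolderNorm_coord_le (hP a) (N + 1) α b).trans (hC a w hw)
  have hPs : ∀ a b, IsContDiff (N + 1 : ℕ) (fun x => partialDeriv a (invLaplacian w) x b) := fun a b =>
    ((hP a).comp_clm (EuclideanSpace.proj b : EuclideanSpace ℝ (Fin 3) →L[ℝ] ℝ)).isContDiff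
      (by exact_mod_cast le_top)
  have hdiff : ∀ a b a' b', Torus.eContDiffHolderNorm (N + 1) α
      ((fun x => partialDeriv a (invLaplacian w) x b) - fun x => partialDeriv a' (invLaplacian w) x b') ≤
      2 * C * Torus.eContDiffHolderNorm N α w := by
    intro a b a' b'
    refine (Torus.eContDiffHolderNorm_sub_le (hPs a b) (hPs a' b')).trans ?_
    calc _ ≤ C * Torus.eContDiffHolderNorm N α w + C * Torus.eContDiffHolderNorm N α w :=
          add_le_add (hPb a b) (hPb a' b')
      _ = 2 * C * Torus.eContDiffHolderNorm N α w := by ring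
  have h0 : (fun x => curl (invLaplacian w) x 0) =
      (fun x => partialDeriv 1 (invLaplacian w) x 2) - fun x => partialDeriv 2 (invLaplacian w) x 1 :=
    funext fun x => by rw [Pi.sub_apply]; exact curl_apply_zero _ _
  have h1 : (fun x => curl (invLaplacian w) x 1) =
      (fun x => partialDeriv 2 (invLaplacian w) x 0) - fun x => partialDeriv 0 (invLaplacian w) x 2 :=
    funext fun x => by rw [Pi.sub_apply]; exact curl_apply_one _ _
  have h2 : (fun x => curl (invLaplacian w) x 2) =
      (fun x => partialDeriv 0 (invLaplacian w) x 1) - fun x => partialDeriv 1 (invLaplacian w) x 0 :=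
    funext fun x => by rw [Pi.sub_apply]; exact curl_apply_two _ _
  calc Torus.eContDiffHolderNorm (N + 1) α (biotSavart w)
      = Torus.eContDiffHolderNorm (N + 1) α (curl (invLaplacian w)) := by
        rw [hB, Torus.eContDiffHolderNorm_neg]
    _ ≤ ∑ c, Torus.eContDiffHolderNorm (N + 1) α (fun x => curl (invLaplacian w) x c) :=
        eContDiffHolderNorm_le_sum_coord hsm (N + 1) α
    _ = Torus.eContDiffHolderNorm (N + 1) α (fun x => curl (invLaplacian w) x 0) +
          Torus.eContDiffHolderNorm (N + 1) α (fun x => curl (invLaplacian w) x 1) +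
          Torus.eContDiffHolderNorm (N + 1) α (fun x => curl (invLaplacian w) x 2) :=
        Fin.sum_univ_three _
    _ ≤ 2 * C * Torus.eContDiffHolderNorm N α w + 2 * C * Torus.eContDiffHolderNorm N α w +
          2 * C * Torus.eContDiffHolderNorm N α w := by
        rw [h0, h1, h2]
        exact add_le_add (add_le_add (hdiff 1 2 2 1) (hdiff 2 0 0 2)) (hdiff 0 1 1 0)
    _ = ((3 * (2 * C) : ℝ≥0) : ℝ≥0∞) * Torus.eContDiffHolderNorm N α w := by
        push_cast
        ring

end Schauder

end BDSV

end Literature.Analysis.FluidPDE
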